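import Summits.BirchSwinnertonDyer.Uniform.U2.ZhaiBoxerDiaoFamilyOddTrace
import Summits.BirchSwinnertonDyer.Rank1Residual.P2.CountsAtTwoZhai16Erratum
import Literature.NumberTheory.EllipticCurves.ManinConstantSemistablePrimewise
import Literature.NumberTheory.EllipticCurves.NonEisensteinPrimeOfSurjective
import Literature.NumberTheory.EllipticCurves.OrdinaryPrimesProofs
import HarnessLib

/-!
# Track U2, route A (cell `bsd-uniform`, seat u2-p1): ERRATUM to the rank-zero Zhai consumers —
# re-bound to Zhai 2016 AS CORRECTED (arXiv v2, 2017: «the Manin constant `ν_E` is odd»), with the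
# odd Manin constant DERIVED from Abbes–Ullmo on Boxer–Diao «good» bases (referee V27/V28, C4-F27)

HONEST FRAMING (cell `bsd-uniform`, HOME run/shared/lean/pub/bsd-uniform/, verbatim in every file of
the seat): a RELATIVE (twist-transport) theorem, uniform in the twisting parameter `M`, CONDITIONAL per
base curve on named invariants of the base; it converts PAIRS, never the class X5; it books nothing,
moves no census number, and no per-curve certificate is counted as a uniform theorem. ALL non-kernel
inputs are PUBLISHED theorems taken BY NAME. THIS FILE is the MIS-STATED-protocol companion of
`TransportARankZero.lean` (`routeA_bsdp_two_twist_iff_of_zhai11` / `…zhai12`, p340800),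
`TransportARankZeroBoxerDiao.lean` (`bsdp_two_twist_of_zhai11_boxerDiao`, p341305) and
`ZhaiBoxerDiaoFamilyOddTrace.lean` (p342096): those theorems bind the arXiv **v1** transcriptions
`Zhai2016.thm11_ordTwo_LAlg_twist_eq_zero` / `thm12_ordTwo_LAlg_twist_eq_one`, which the tree's own
`Zhai2016/NonvanishingQuadraticTwistsErratum.lean` (b2b p2-typer) records as STRONGER than the author's
corrected statements whenever the conductor is even (arXiv v2 standing assumption «the Manin constant
`ν_E` is odd», Abbes–Ullmo for odd conductor). Referee V27 F27-1 / V28 (2026-08-26): kernel-sound as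
conditionals, but «every input PRINTED» is not earned for them (CONVERSIONS U2-c label PUB* with the
marker until re-bound). The old declarations stay UNTOUCHED (byte-identical, importable); here, beside
them, the PRIMED TWINS bound to the corrected facts `thm11_ordTwo_LAlg_twist_eq_zero'` /
`thm12_ordTwo_LAlg_twist_eq_one'` through the p2 lane's corrected count forms
`P2.bsdp_two_twist_iff_of_zhai11'` / `…zhai12'` (`CountsAtTwoZhai16Erratum.lean`):

* `routeA_bsdp_two_twist_iff_of_zhai11'`, `routeA_bsdp_two_twist_iff_of_zhai12'` — the general-base
  iffs with the EXPLICIT extra binder `hν : ¬ 2 ∣ Dt.c` (odd Manin constant of the optimal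
  parametrisation; for odd conductor it is Abbes–Ullmo 1996 Thm. A, for `2 ∥ N` Česnavičius 2018 —
  named facts of `ManinConstantSemistablePrimewise.lean` a consumer may feed);
* `not_two_dvd_minimalDiscriminantInt_of_a₁_eq_zero_of_a₃_eq_one`, `IsGood.hasGoodReductionAtPrime_two`,
  `IsGood.not_two_dvd_conductorNorm`, `IsGood.not_two_dvd_c` — on a Boxer–Diao «good» base the binder is
  NOT a new per-curve hypothesis: `IsGood` (4) says the minimal model is `y² + y = x³ + a₂x² + a₄x + a₆`
  (`a₁ = 0`, `a₃ = 1`), so `Δ ≡ −27 b₆² ≡ 1 (mod 2)` is ODD, `E` has good reduction at `2`, `2 ∤ N`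
  (`not_dvd_conductorNorm_of_hasGoodReductionAtPrime`), and Abbes–Ullmo Thm. A
  (`abbesUllmo_not_dvd_maninConstant_of_not_dvd_level`, named fact `hAU`, PUBLISHED) gives `2 ∤ ν_E`;
* `bsdp_two_twist_of_zhai11'_boxerDiao`, `bsdp_two_twist_of_zhai11'_boxerDiao_of_odd_frobeniusTrace` —
  the Zhai–Boxer–Diao family (Zhai's printed remark after Thm 1.1) re-bound: inputs Zhai Thm 1.1 AS
  CORRECTED (`h11'`), Abbes–Ullmo Thm. A (`hAU`), Boxer–Diao Thm 1.1 / Prop 4.1, modularity; SAME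
  binders on `(E, M)` as p341305 (no `hν`), same conclusion `r_an = 0`, rank `0`, `Ш[2^∞] = 0`,
  `∏ c_ℓ` odd, `BSD(E^{(M)}, 2)`.

Numbers unchanged (the booked head does not consume Zhai): 0/13, «66.85 % → 66.85 %», α = 0 / β = 0.00.

References: S. Zhai, Asian J. Math. 20 (2016) 475–502 and arXiv:1409.0231v2 (2017) Thm 1.1 / 1.3 with
the standing assumption [Zhai2016]; A. Abbes, E. Ullmo, Compositio Math. 103 (1996) Thm. A
[AbbesUllmo1996]; G. Boxer, P. Diao, PAMS 138 (2010) Thm 1.1, Prop 4.1, Remark p. 1971 [BoxerDiao2010];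
Mazur–Rubin 2010 Cor. 3.4 (ii) [MazurRubin2010]; Miller 2011 Def 1.1 [Miller2011LMS].
-/

noncomputable section

open scoped Classical AddSubgroup

open NumberField WeierstrassCurve Literature.NumberTheory.EllipticCurves
  Literature.NumberTheory.EllipticCurves.ModularForms
  Literature.NumberTheory.EllipticCurves.Rank1Residual
  Literature.NumberTheory.EllipticCurves.CoatesLiTianZhai2015
  Literature.NumberTheory.EllipticCurves.Zhai2016
  Summit.BirchSwinnertonDyer.Rank1Residual

namespace Summit.BirchSwinnertonDyer.Uniform.U2

/-! ### A Boxer–Diao «good» base has odd discriminant, good reduction at `2`, odd conductor, odd `ν_E` -/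

section GoodAtTwo

variable {W : WeierstrassCurve ℚ} [W.IsElliptic] [W.IsGloballyMinimal]

omit [W.IsElliptic] in
/-- **`a₁ = 0`, `a₃ = 1` ⇒ the minimal discriminant is odd**: with `b₂ = 4a₂`, `b₄ = 2a₄`,
`b₆ = 1 + 4a₆`, `Δ = −b₂²b₈ − 8b₄³ − 27b₆² + 9b₂b₄b₆ ≡ −27 ≡ 1 (mod 2)` (Boxer–Diao p. 1971, Remark:
"such a curve has good reduction at `2`"). Computed in `ℤ/2` on the integral model.
[cite: BoxerDiao2010, Remark p. 1971] -/
theorem not_two_dvd_minimalDiscriminantInt_of_a₁_eq_zero_of_a₃_eq_one (h1 : W.a₁ = 0)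
    (h3 : W.a₃ = 1) : ¬ (2 : ℤ) ∣ minimalDiscriminantInt W := by
  set M : WeierstrassCurve ℤ := integralModelInt W with hMdef
  have hM : M.map (Int.castRingHom ℚ) = W := map_integralModelInt W
  have ha1 : M.a₁ = 0 := by
    have h : ((M.a₁ : ℤ) : ℚ) = W.a₁ := by rw [← hM]; simp [WeierstrassCurve.map]
    rw [h1] at h
    exact_mod_cast h
  have ha3 : M.a₃ = 1 := by
    have h : ((M.a₃ : ℤ) : ℚ) = W.a₃ := by rw [← hM]; simp [WeierstrassCurve.map]
    rw [h3] at h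
    exact_mod_cast h
  intro h2
  -- reduce modulo `2`
  set φ : ℤ →+* ZMod 2 := Int.castRingHom (ZMod 2) with hφ
  have hzero : (M.map φ).Δ = 0 := by
    rw [WeierstrassCurve.map_Δ, hφ, eq_intCast]
    exact (ZMod.intCast_zmod_eq_zero_iff_dvd M.Δ 2).mpr h2
  have hval : (M.map φ).Δ = -27 * (1 + 4 * φ M.a₆) ^ 2 - (4 * φ M.a₂) ^ 2 *
      ((4 * φ M.a₂) * φ M.a₆ + φ M.a₂ - (φ M.a₄) ^ 2 + 0) - 8 * (2 * φ M.a₄) ^ 3 +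
      9 * (4 * φ M.a₂) * (2 * φ M.a₄) * (1 + 4 * φ M.a₆) := by
    simp only [WeierstrassCurve.map, WeierstrassCurve.Δ, WeierstrassCurve.b₂, WeierstrassCurve.b₄,
      WeierstrassCurve.b₆, WeierstrassCurve.b₈, ha1, ha3, map_zero, map_one]
    ring
  rw [hval] at hzero
  generalize φ M.a₂ = x at hzero
  generalize φ M.a₄ = y at hzero
  generalize φ M.a₆ = z at hzero
  revert hzero x y z
  decide

omit [W.IsElliptic] in
/-- **A Boxer–Diao «good» curve has good reduction at `2`** (condition (4): minimal model
`y² + y = x³ + a₂x² + a₄x + a₆`, so `Δ_min` is odd). [cite: BoxerDiao2010, Remark p. 1971] -/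
theorem IsGood.hasGoodReductionAtPrime_two (hgood : BoxerDiao2010.IsGood W) :
    W.HasGoodReductionAtPrime 2 :=
  haveI : Fact (Nat.Prime 2) := ⟨Nat.prime_two⟩
  hasGoodReductionAtPrime_of_not_dvd W 2
    (not_two_dvd_minimalDiscriminantInt_of_a₁_eq_zero_of_a₃_eq_one hgood.2.2.2.1 hgood.2.2.2.2)

/-- **A Boxer–Diao «good» curve has odd conductor** (`2 ∤ N_E`: good reduction at `2`, Silverman
ATAEC IV.10.2 (a), `not_dvd_conductorNorm_of_hasGoodReductionAtPrime`). [cite: BoxerDiao2010, Remark p. 1971] -/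
theorem IsGood.not_two_dvd_conductorNorm (hgood : BoxerDiao2010.IsGood W) :
    ¬ 2 ∣ W.conductorNorm ℤ :=
  haveI : Fact (Nat.Prime 2) := ⟨Nat.prime_two⟩
  not_dvd_conductorNorm_of_hasGoodReductionAtPrime W (IsGood.hasGoodReductionAtPrime_two hgood)

/-- **On a Boxer–Diao «good» base the Manin constant of the optimal parametrisation is odd**
(Abbes–Ullmo 1996 Thm. A, `p ∤ N ⇒ p ∤ ν_E`, at `p = 2`; named fact `hAU`): Zhai's arXiv-v2 standing
assumption is a THEOREM on this class, not a per-curve binder. [cite: AbbesUllmo1996, Thm. A] [cite: BoxerDiao2010, Remark p. 1971] -/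
theorem IsGood.not_two_dvd_c (hAU : abbesUllmo_not_dvd_maninConstant_of_not_dvd_level)
    [NeZero (W.conductorNorm ℤ)] (Dt : ModularParametrizationData W (W.conductorNorm ℤ))
    (hopt : Zhai2021.IsOptimalDatum W Dt) (hgood : BoxerDiao2010.IsGood W) : ¬ (2 : ℤ) ∣ Dt.c :=
  hAU W Dt hopt 2 Nat.prime_two (IsGood.not_two_dvd_conductorNorm hgood)

end GoodAtTwo

/-! ### The general-base iffs, corrected binders (explicit `2 ∤ ν_E`) -/

section RankZero

variable {W : WeierstrassCurve ℚ} [W.IsElliptic] [W.IsGloballyMinimal] [NeZero (W.conductorNorm ℤ)]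

/-- **ROUTE A, RANK-ZERO MEMBER CLOSED AT `2` — Zhai 2016 Thm 1.1 AS CORRECTED (arXiv v2: odd Manin
constant) ∘ Mazur–Rubin 2010 Cor 3.4 (ii).** As `routeA_bsdp_two_twist_iff_of_zhai11` with the corrected
fact `thm11_ordTwo_LAlg_twist_eq_zero'` and the extra binder `hν : ¬ 2 ∣ Dt.c` (odd Manin constant of the
optimal parametrisation — Abbes–Ullmo for odd conductor): `r_an(E^{(M)}) = 0`, `rank E^{(M)}(ℚ) = 0`,
`Ш(E^{(M)}/ℚ)[2^∞] = 0`, and `BSD(E^{(M)}, 2) ⟺ ord₂ ∏_ℓ c_ℓ(E^{(M)}) = 0`.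
[cite: Zhai2016, Thm. 1.1 (arXiv:1409.0231v2 TeX ll. 273–279; standing assumption ll. 255–263)]
[cite: MazurRubin2010, Cor. 3.4 (ii) with Prop. 3.3] [cite: Miller2011LMS, Def. 1.1] -/
theorem routeA_bsdp_two_twist_iff_of_zhai11' (h11 : thm11_ordTwo_LAlg_twist_eq_zero')
    (hMR : MazurRubin2010.cor34ii_rat) (hmod : hasEntireLFunction_rat)
    (hGZK : rank_eq_analyticRank_of_analyticRank_le_one)
    (Dt : ModularParametrizationData W (W.conductorNorm ℤ)) (hopt : Zhai2021.IsOptimalDatum W Dt)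
    (hν : ¬ (2 : ℤ) ∣ Dt.c)
    (hΔ : W.Δ < 0) (h1 : Nat.card {P : W.toAffine.Point // (2 : ℕ) • P = 0} = 1)
    (hL : ∃ x : ℚ, IsLAlg W x ∧ x ≠ 0 ∧ padicValRat 2 x = 0) (hWsha : (W.sha)[(2 : ℤ)] = ⊥)
    (F₃ : Type) [Field F₃] [NumberField F₃] (hF₃ : IsTwoDivisionField W F₃)
    (M : ℤ) (hsq : Squarefree M) (hM4 : M % 4 = 1) (hM1 : M ≠ 1)
    (hgcd : Int.gcd M (W.conductorNorm ℤ) = 1) (hne : M.natAbs.primeFactors.Nonempty)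
    (hin : ∀ q ∈ M.natAbs.primeFactors, q ≠ 2 ∧ IsInertIn F₃ q)
    -- Mazur–Rubin control binders for `F₂ = ℚ(√M)`
    (F₂ : Type) [Field F₂] [NumberField F₂] (hF₂ : Module.finrank ℚ F₂ = 2)
    (hxM : ∃ y : F₂, y ^ 2 = (M : F₂))
    (hadd : ∀ (p : ℕ) [Fact p.Prime], ¬ W.HasGoodReductionAtPrime p →
      ¬ W.HasMultiplicativeReductionAtPrime p → ((Ideal.span {(p : ℤ)}).primesOver (𝓞 F₂)).ncard = 2)
    (hmev : ∀ (p : ℕ) [Fact p.Prime], W.HasMultiplicativeReductionAtPrime p →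
      Even (padicValRat p W.Δ) → ((Ideal.span {(p : ℤ)}).primesOver (𝓞 F₂)).ncard = 2)
    (h2 : ((Ideal.span {(2 : ℤ)}).primesOver (𝓞 F₂)).ncard = 2)
    (hmodd : ∀ (p : ℕ) [Fact p.Prime], W.HasMultiplicativeReductionAtPrime p →
      Odd (padicValRat p W.Δ) → ¬ (p : ℤ) ∣ NumberField.discr F₂)
    (hT : ∀ (p : ℕ) [Fact p.Prime], (p : ℤ) ∣ NumberField.discr F₂ →
      ∀ Q : (W.baseChange ℚ_[p]).toAffine.Point, 2 • Q = 0 → Q = 0)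
    {WM : WeierstrassCurve ℚ} [WM.IsElliptic] [WM.IsGloballyMinimal]
    (hWM : ∃ C : VariableChange ℚ, C • W.quadraticTwist (M : ℚ) = WM) :
    WM.analyticRank = 0 ∧ WM.mordellWeilRank = 0 ∧ AddCommGroup.primaryComponent WM.sha 2 = ⊥ ∧
      (BSDp WM 2 ↔ padicValNat 2 WM.tamagawaProduct = 0) := by
  -- Zhai (analytic side, corrected) in the p2 lane's corrected count form
  obtain ⟨hr, hiff⟩ := P2.bsdp_two_twist_iff_of_zhai11' h11 hmod Dt hopt hν hΔ h1 hL F₃ hF₃ M hsq hM4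
    hgcd hne hin hWM
  obtain ⟨-, -, -, hfinSha⟩ := h11 W Dt hopt hν hΔ h1 hL F₃ hF₃ M hsq hM4 hgcd hne hin WM hWM
  haveI := hfinSha
  -- base data
  obtain ⟨x, hx, hx0, -⟩ := hL
  obtain ⟨hrank, hW2⟩ := base_rank_zero_and_torsionBy_two_eq_bot hmod hGZK h1 hx hx0
  -- route A, rank-zero case (MR control; `Δ < 0` makes the real-place binder vacuous)
  have hreal : 0 < W.Δ → NumberField.IsTotallyReal F₂ := fun h => absurd h (not_lt.mpr hΔ.le)
  obtain ⟨hrM, -, hshaM⟩ := routeA_rank_zero W hMR hsq hM1 F₂ hF₂ hxM hadd hmev h2 hreal hmodd hT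
    hW2 hWsha hrank WM (P2.exists_smul_eq_comm.mp hWM)
  refine ⟨hr, hrM, hshaM, hiff.trans ?_⟩
  rw [padicValNat_card_eq_zero_of_primaryComponent_eq_bot 2 hshaM]
  omega

/-- **ROUTE A, RANK-ZERO MEMBER CLOSED AT `2`, positive discriminant — Zhai 2016 Thm 1.2 AS CORRECTED
(arXiv v2 Thm 1.3: odd Manin constant) ∘ Mazur–Rubin 2010 Cor 3.4 (ii).** As
`routeA_bsdp_two_twist_iff_of_zhai12` with the corrected fact `thm12_ordTwo_LAlg_twist_eq_one'` and the
extra binder `hν : ¬ 2 ∣ Dt.c`.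
[cite: Zhai2016, Thm. 1.2 (arXiv:1409.0231v2 Thm. 1.3, TeX ll. 315–321; standing assumption ll. 255–263)]
[cite: MazurRubin2010, Cor. 3.4 (ii) with Prop. 3.3] [cite: Miller2011LMS, Def. 1.1] -/
theorem routeA_bsdp_two_twist_iff_of_zhai12' (h12 : thm12_ordTwo_LAlg_twist_eq_one')
    (hMR : MazurRubin2010.cor34ii_rat) (hmod : hasEntireLFunction_rat)
    (hGZK : rank_eq_analyticRank_of_analyticRank_le_one)
    (Dt : ModularParametrizationData W (W.conductorNorm ℤ)) (hopt : Zhai2021.IsOptimalDatum W Dt)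
    (hν : ¬ (2 : ℤ) ∣ Dt.c)
    (hΔ : 0 < W.Δ) (h1 : Nat.card {P : W.toAffine.Point // (2 : ℕ) • P = 0} = 1)
    (hL : ∃ x : ℚ, IsLAlg W x ∧ x ≠ 0 ∧ padicValRat 2 x = 1) (hWsha : (W.sha)[(2 : ℤ)] = ⊥)
    (F₃ : Type) [Field F₃] [NumberField F₃] (hF₃ : IsTwoDivisionField W F₃)
    (M : ℤ) (hMpos : 0 < M) (hsq : Squarefree M) (hM4 : M % 4 = 1) (hM1 : M ≠ 1)
    (hgcd : Int.gcd M (W.conductorNorm ℤ) = 1) (hne : M.natAbs.primeFactors.Nonempty)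
    (hin : ∀ q ∈ M.natAbs.primeFactors, q ≠ 2 ∧ IsInertIn F₃ q)
    (F₂ : Type) [Field F₂] [NumberField F₂] (hF₂ : Module.finrank ℚ F₂ = 2)
    (hxM : ∃ y : F₂, y ^ 2 = (M : F₂)) (hreal : NumberField.IsTotallyReal F₂)
    (hadd : ∀ (p : ℕ) [Fact p.Prime], ¬ W.HasGoodReductionAtPrime p →
      ¬ W.HasMultiplicativeReductionAtPrime p → ((Ideal.span {(p : ℤ)}).primesOver (𝓞 F₂)).ncard = 2)
    (hmev : ∀ (p : ℕ) [Fact p.Prime], W.HasMultiplicativeReductionAtPrime p →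
      Even (padicValRat p W.Δ) → ((Ideal.span {(p : ℤ)}).primesOver (𝓞 F₂)).ncard = 2)
    (h2 : ((Ideal.span {(2 : ℤ)}).primesOver (𝓞 F₂)).ncard = 2)
    (hmodd : ∀ (p : ℕ) [Fact p.Prime], W.HasMultiplicativeReductionAtPrime p →
      Odd (padicValRat p W.Δ) → ¬ (p : ℤ) ∣ NumberField.discr F₂)
    (hT : ∀ (p : ℕ) [Fact p.Prime], (p : ℤ) ∣ NumberField.discr F₂ →
      ∀ Q : (W.baseChange ℚ_[p]).toAffine.Point, 2 • Q = 0 → Q = 0)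
    {WM : WeierstrassCurve ℚ} [WM.IsElliptic] [WM.IsGloballyMinimal]
    (hWM : ∃ C : VariableChange ℚ, C • W.quadraticTwist (M : ℚ) = WM) :
    WM.analyticRank = 0 ∧ WM.mordellWeilRank = 0 ∧ AddCommGroup.primaryComponent WM.sha 2 = ⊥ ∧
      (BSDp WM 2 ↔ padicValNat 2 WM.tamagawaProduct = 0) := by
  obtain ⟨hr, hiff⟩ := P2.bsdp_two_twist_iff_of_zhai12' h12 hmod Dt hopt hν hΔ h1 hL F₃ hF₃ M hMpos
    hsq hM4 hgcd hne hin hWM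
  obtain ⟨-, -, -, hfinSha⟩ := h12 W Dt hopt hν hΔ h1 hL F₃ hF₃ M hMpos hsq hM4 hgcd hne hin WM hWM
  haveI := hfinSha
  obtain ⟨x, hx, hx0, -⟩ := hL
  obtain ⟨hrank, hW2⟩ := base_rank_zero_and_torsionBy_two_eq_bot hmod hGZK h1 hx hx0
  obtain ⟨hrM, -, hshaM⟩ := routeA_rank_zero W hMR hsq hM1 F₂ hF₂ hxM hadd hmev h2 (fun _ => hreal)
    hmodd hT hW2 hWsha hrank WM (P2.exists_smul_eq_comm.mp hWM)
  refine ⟨hr, hrM, hshaM, hiff.trans ?_⟩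
  rw [padicValNat_card_eq_zero_of_primaryComponent_eq_bot 2 hshaM]
  omega

end RankZero

/-! ### The Zhai–Boxer–Diao family, corrected binders (no new per-curve hypothesis) -/

section Family

variable {W : WeierstrassCurve ℚ} [W.IsElliptic] [W.IsGloballyMinimal] [NeZero (W.conductorNorm ℤ)]

/-- **THE ZHAI–BOXER–DIAO FAMILY, re-bound to Zhai 2016 AS CORRECTED.** As
`bsdp_two_twist_of_zhai11_boxerDiao` (Zhai's printed remark after Thm 1.1), with the analytic input the
CORRECTED fact `thm11_ordTwo_LAlg_twist_eq_zero'` (arXiv v2: odd Manin constant) and the new binder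
DISCHARGED on the class: a «good» base has good reduction at `2`, hence odd conductor, hence odd `ν_E`
by Abbes–Ullmo Thm. A (`hAU`). Same binders on `(E, M)` as before; conclusion `r_an(E^{(M)}) = 0`,
`rank E^{(M)}(ℚ) = 0`, `Ш(E^{(M)}/ℚ)[2^∞] = 0`, `∏_ℓ c_ℓ(E^{(M)})` odd, `BSD(E^{(M)}, 2)`. Inputs by
name: Zhai Thm 1.1 corrected (`h11`), Abbes–Ullmo Thm. A (`hAU`), Boxer–Diao Thm 1.1 (`hBD`) and
Prop 4.1 (`hBD4`), modularity (`hmod`). No novelty claimed (printed remark).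
[cite: Zhai2016, Thm. 1.1 and the remark after it (arXiv:1409.0231v2 TeX ll. 273–279, 255–263)]
[cite: AbbesUllmo1996, Thm. A] [cite: BoxerDiao2010, Thm. 1.1 (p. 1971) and Prop. 4.1 (p. 1976)]
[cite: Miller2011LMS, Def. 1.1] -/
theorem bsdp_two_twist_of_zhai11'_boxerDiao (h11 : thm11_ordTwo_LAlg_twist_eq_zero')
    (hAU : abbesUllmo_not_dvd_maninConstant_of_not_dvd_level)
    (hBD : BoxerDiao2010.thm11_sel2_twist) (hBD4 : BoxerDiao2010.prop41_tamagawa_twist)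
    (hmod : hasEntireLFunction_rat)
    (Dt : ModularParametrizationData W (W.conductorNorm ℤ)) (hopt : Zhai2021.IsOptimalDatum W Dt)
    (hgood : BoxerDiao2010.IsGood W)
    (hL : ∃ x : ℚ, IsLAlg W x ∧ x ≠ 0 ∧ padicValRat 2 x = 0)
    (F : Type) [Field F] [NumberField F] (hF : IsTwoDivisionField W F)
    (M : ℤ) (hsq : Squarefree M) (hM4 : M % 4 = 1)
    (hgcdN : Int.gcd M (W.conductorNorm ℤ) = 1) (hgcdΔ : Int.gcd M (minimalDiscriminantInt W) = 1)
    (hne : M.natAbs.primeFactors.Nonempty) (hin : ∀ q ∈ M.natAbs.primeFactors, q ≠ 2 ∧ IsInertIn F q)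
    (htriv : BoxerDiao2010.IsTwoTrivial W M)
    {WM : WeierstrassCurve ℚ} [WM.IsElliptic] [WM.IsGloballyMinimal]
    (hWM : ∃ C : VariableChange ℚ, C • W.quadraticTwist (M : ℚ) = WM) :
    WM.analyticRank = 0 ∧ WM.mordellWeilRank = 0 ∧ AddCommGroup.primaryComponent WM.sha 2 = ⊥ ∧
      Odd WM.tamagawaProduct ∧ BSDp WM 2 := by
  have hsel : Nat.card (W.selmerGroup 2) = 1 := hgood.1
  have hΔ : W.Δ < 0 := hgood.2.1
  -- the corrected binder, discharged on the class: `2 ∤ ν_E` (Abbes–Ullmo, `2 ∤ N`)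
  have hν : ¬ (2 : ℤ) ∣ Dt.c := IsGood.not_two_dvd_c hAU Dt hopt hgood
  -- base: `Sel₂(E) = 0` ⇒ `E(ℚ)[2] = ⊥` ⇒ Zhai's binder `#E(ℚ)[2] = 1`
  obtain ⟨-, hW2, -⟩ := rank_eq_zero_and_sha_two_eq_bot_of_card_selmerGroup_two_eq_one W hsel
  have h1 : Nat.card {P : W.toAffine.Point // (2 : ℕ) • P = 0} = 1 :=
    natCard_twoTorsionSubtype_eq_one_of_torsionBy_eq_bot hW2
  -- Zhai (analytic side, corrected), count form
  obtain ⟨hr, hiff⟩ := P2.bsdp_two_twist_iff_of_zhai11' h11 hmod Dt hopt hν hΔ h1 hL F hF M hsq hM4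
    hgcdN hne hin hWM
  obtain ⟨-, -, -, hfinSha⟩ := h11 W Dt hopt hν hΔ h1 hL F hF M hsq hM4 hgcdN hne hin WM hWM
  haveI := hfinSha
  -- Boxer–Diao Thm 1.1 (M odd): `Sel₂(E^{(M)}) = 0`; the kernel: rank 0 and `Ш[2^∞] = 0`
  have hWM' : ∃ C : VariableChange ℚ, C • WM = W.quadraticTwist (M : ℚ) := P2.exists_smul_eq_comm.mp hWM
  have hModd : Odd M := Int.odd_iff.mpr (by omega)
  have hselM : Nat.card (WM.selmerGroup 2) = 1 := (hBD W hgood M hsq htriv hgcdΔ WM hWM').1 hModd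
  obtain ⟨hrM, -, hshaM⟩ := rank_eq_zero_and_sha_two_eq_bot_of_card_selmerGroup_two_eq_one WM hselM
  -- Boxer–Diao Prop 4.1 (1): Tamagawa product odd
  have hc : Odd WM.tamagawaProduct := ((hBD4 W hgood M hsq WM hWM').1 hgcdΔ).mpr htriv
  have hc0 : padicValNat 2 WM.tamagawaProduct = 0 :=
    padicValNat.eq_zero_of_not_dvd (fun h2 => (Nat.not_even_iff_odd.mpr hc) (even_iff_two_dvd.mpr h2))
  refine ⟨hr, hrM, hshaM, hc, hiff.mpr ?_⟩
  rw [padicValNat_card_eq_zero_of_primaryComponent_eq_bot 2 hshaM, hc0]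

/-- **The Zhai–Boxer–Diao family, corrected binders, «`a_q` odd» form.** As
`bsdp_two_twist_of_zhai11'_boxerDiao` with Boxer–Diao's «2-trivial» binder replaced by: `a_q(E)` is odd
for every odd prime `q ∣ M` (`isTwoTrivial_iff_forall_odd_frobeniusTrace`).
[cite: Zhai2016, Thm. 1.1 and the remark after it (arXiv:1409.0231v2)] [cite: AbbesUllmo1996, Thm. A]
[cite: BoxerDiao2010, Thm. 1.1 and Prop. 4.1] -/
theorem bsdp_two_twist_of_zhai11'_boxerDiao_of_odd_frobeniusTrace
    (h11 : thm11_ordTwo_LAlg_twist_eq_zero')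
    (hAU : abbesUllmo_not_dvd_maninConstant_of_not_dvd_level)
    (hBD : BoxerDiao2010.thm11_sel2_twist) (hBD4 : BoxerDiao2010.prop41_tamagawa_twist)
    (hmod : hasEntireLFunction_rat)
    (Dt : ModularParametrizationData W (W.conductorNorm ℤ)) (hopt : Zhai2021.IsOptimalDatum W Dt)
    (hgood : BoxerDiao2010.IsGood W)
    (hL : ∃ x : ℚ, IsLAlg W x ∧ x ≠ 0 ∧ padicValRat 2 x = 0)
    (F : Type) [Field F] [NumberField F] (hF : IsTwoDivisionField W F)
    (M : ℤ) (hsq : Squarefree M) (hM4 : M % 4 = 1)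
    (hgcdN : Int.gcd M (W.conductorNorm ℤ) = 1) (hgcdΔ : Int.gcd M (minimalDiscriminantInt W) = 1)
    (hne : M.natAbs.primeFactors.Nonempty) (hin : ∀ q ∈ M.natAbs.primeFactors, q ≠ 2 ∧ IsInertIn F q)
    (hodd : ∀ (q : ℕ), q.Prime → q ≠ 2 → (q : ℤ) ∣ M → Odd (W.frobeniusTrace q))
    {WM : WeierstrassCurve ℚ} [WM.IsElliptic] [WM.IsGloballyMinimal]
    (hWM : ∃ C : VariableChange ℚ, C • W.quadraticTwist (M : ℚ) = WM) :
    WM.analyticRank = 0 ∧ WM.mordellWeilRank = 0 ∧ AddCommGroup.primaryComponent WM.sha 2 = ⊥ ∧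
      Odd WM.tamagawaProduct ∧ BSDp WM 2 :=
  bsdp_two_twist_of_zhai11'_boxerDiao h11 hAU hBD hBD4 hmod Dt hopt hgood hL F hF M hsq hM4 hgcdN hgcdΔ
    hne hin ((isTwoTrivial_iff_forall_odd_frobeniusTrace W M).mpr hodd) hWM

end Family

end Summit.BirchSwinnertonDyer.Uniform.U2

end
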